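import Summits.AtomisticToContinuum.HydrodynamicLimit.Theses.ImplosionDichotomy
import Summits.AtomisticToContinuum.HydrodynamicLimit.Theorems.DenseExcursion.Negative.Untied
import Literature.MathematicalPhysics.KineticTheory.HardSphereEulerLLN

/-!
# drefute gen 2 — mutations of `stub_logBudgetShadowing` (line `log-lipschitz-budget`, crux stmt-AtomisticToContinuum-12587)

`Stub4WithoutRate` is STUB 4 of `Cruxes/PolynomialCompression/Lines/log-lipschitz-budget.lean` VERBATIM with the single
hypothesis `hrate` (`∀ n, ∃ Cn, ∀ σ ∈ (0,σ₁), ‖Dⁿ lift(ρs σ − β₀)‖ ≤ Cn σ³`) deleted. It is FALSE as soon as the stub's own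
equation-of-state hypotheses `(η₀, F)` are satisfiable (they are the unbundled `HsEosLowDensity`, stmt-0768, which the line's
composition needs anyway): constant reference `(1, 0, 1)` on `[0, 1)` (a classical σ = 0 solution, isentropic with `K = 1`,
Type-I with `C = 0`, all derivative bounds with `Cn = 1, pn = 0`, floor `cl = 1, pl = 0`) against the constant data family
`ρs σ ≡ 1/100`, whose σ-solutions include the constant state `(1/100, 0, 1)`; the shadowing inequality `ρ₁ ≤ 2ρ` fails at
`t = 0 < T₁ − σ^e/2`. Hence ANY proof of stub 4 must use the `O(σ³)` statics rate (it cannot be weakened to "some smooth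
positive family"); equivalently `Stub4WithoutRate → ¬(∃ η₀ F, …)` — a rate-free stub 4 would refute 0768.
(`hrate` weakened to an o(1) sup-norm rate is NOT decidable by constant states: only imploding references see the rate.)
-/

noncomputable section

namespace Summit.AtomisticToContinuum.HydrodynamicLimit.Cruxes.PolynomialCompression.DrefuteG2

open Set MeasureTheory Filter
open Literature.MathematicalPhysics.KineticTheory
open Literature.Analysis.FunctionSpaces
open Summit.AtomisticToContinuum.HydrodynamicLimit.Theorems.DenseExcursionUntied (isHardSphereEulerSolution_const)

/-- STUB 4 with the statics-rate hypothesis `hrate` deleted (everything else verbatim). -/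
def Stub4WithoutRate : Prop :=
    ∀ η₀ : ℝ, 0 < η₀ → ∀ F : ℝ → ℝ, AnalyticOnNhd ℝ F (Ioo (-η₀) η₀) →
      EqOn hsExcessFreeEnergy F (Ico 0 η₀) → F 0 = 0 → deriv F 0 = 2 * Real.pi / 3 →
    ∀ (β₀ θ₀ : T3 → ℝ) (u₀ : T3 → V3) (T₁ K : ℝ) (ρ₁ θ₁ : ℝ → T3 → ℝ) (u₁ : ℝ → T3 → V3),
      0 < T₁ → 0 < K → IsHardSphereEulerSolution 0 T₁ ρ₁ u₁ θ₁ →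
      (∀ x, ρ₁ 0 x = β₀ x) → u₁ 0 = u₀ → θ₁ 0 = θ₀ →
      (∀ t ∈ Ico 0 T₁, ∀ x, θ₁ t x = K * ρ₁ t x ^ (2 / 3 : ℝ)) →
      (∃ C : ℝ, ∀ t ∈ Ico 0 T₁, ∀ x, ∀ i : Fin 3,
          ‖Torus.partialDeriv i (u₁ t) x‖ ≤ C / (T₁ - t) ∧
          |Torus.partialDeriv i (fun y => ρ₁ t y ^ (1 / 3 : ℝ)) x| ≤ C / (T₁ - t)) →
      (∀ n : ℕ, ∃ Cn pn : ℝ, ∀ t ∈ Ico 0 T₁, ∀ y : EuclideanSpace ℝ (Fin 3),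
          ‖iteratedFDeriv ℝ n (Torus.lift (ρ₁ t)) y‖ ≤ Cn * (T₁ - t) ^ (-pn) ∧
          ‖iteratedFDeriv ℝ n (Torus.lift (u₁ t)) y‖ ≤ Cn * (T₁ - t) ^ (-pn)) →
      (∃ cl pl : ℝ, 0 < cl ∧ ∀ t ∈ Ico 0 T₁, ∀ x, cl * (T₁ - t) ^ pl ≤ ρ₁ t x) →
    ∀ (ρs : ℝ → T3 → ℝ) (σ₁ : ℝ), 0 < σ₁ →
      (∀ σ : ℝ, 0 < σ → σ < σ₁ → Torus.IsSmooth (ρs σ) ∧ ∀ x, 0 < ρs σ x) →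
    ∀ η : ℝ, 0 < η →
      ∃ e : ℝ, 0 < e ∧ ∃ σ₂ : ℝ, 0 < σ₂ ∧ σ₂ ≤ σ₁ ∧ ∀ σ : ℝ, 0 < σ → σ < σ₂ →
        σ ^ e < T₁ ∧ (∀ x, ρs σ x * σ ^ 3 ≤ η) ∧
        ∃ M : ℝ, 0 < M ∧ ∀ T : ℝ, T ≤ T₁ - σ ^ e / 2 → ∀ (ρ θ : ℝ → T3 → ℝ) (u : ℝ → T3 → V3),
          IsHardSphereEulerSolution σ T ρ u θ → ρ 0 = ρs σ → u 0 = u₀ → θ 0 = θ₀ →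
          ∀ t ∈ Ico 0 T, ∀ x,
            (M⁻¹ ≤ ρ t x ∧ ρ t x ≤ M ∧ M⁻¹ ≤ θ t x ∧ θ t x ≤ M ∧ ‖u t x‖ ≤ M ∧
              ρ t x * σ ^ 3 ≤ η ∧
              ∀ i : Fin 3, ‖Torus.partialDeriv i (u t) x‖ ≤ M ∧
                |Torus.partialDeriv i (ρ t) x| ≤ M ∧ |Torus.partialDeriv i (θ t) x| ≤ M) ∧
            ρ₁ t x ≤ 2 * ρ t x

/-- `∂ᵢ` of a constant field on the torus vanishes. -/
theorem partialDeriv_const {F : Type*} [NormedAddCommGroup F] [NormedSpace ℝ F] (c : F) (i : Fin 3) (x : T3) :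
    Torus.partialDeriv i (fun _ : T3 => c) x = 0 := by
  simp [Torus.partialDeriv, Torus.lineDeriv]

/-- All derivatives of the lift of a constant field are bounded by `‖c‖`. -/
theorem norm_iteratedFDeriv_lift_const_le {F : Type*} [NormedAddCommGroup F] [NormedSpace ℝ F] (c : F) (n : ℕ)
    (y : EuclideanSpace ℝ (Fin 3)) : ‖iteratedFDeriv ℝ n (Torus.lift (fun _ : T3 => c)) y‖ ≤ ‖c‖ := by
  have hl : Torus.lift (fun _ : T3 => c) = fun _ : EuclideanSpace ℝ (Fin 3) => c := rfl
  rw [hl]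
  rcases Nat.eq_zero_or_pos n with rfl | hn
  · simp
  · rw [iteratedFDeriv_const_of_ne (Nat.pos_iff_ne_zero.1 hn)]
    simp

/-- The twelve reference/statics hypotheses of STUB 4 other than `hrate` are met by CONSTANT states: if the EOS hypotheses
are satisfiable, the rate-free stub 4 is false. [folklore] -/
theorem stub4_false_without_rate {η₀ : ℝ} (hη₀ : 0 < η₀) {F : ℝ → ℝ} (hF : AnalyticOnNhd ℝ F (Ioo (-η₀) η₀))
    (hEq : EqOn hsExcessFreeEnergy F (Ico 0 η₀)) (hF0 : F 0 = 0) (hF' : deriv F 0 = 2 * Real.pi / 3) :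
    ¬ Stub4WithoutRate := by
  intro H
  have h := H η₀ hη₀ F hF hEq hF0 hF' (fun _ => 1) (fun _ => 1) (fun _ => 0) 1 1
    (fun _ _ => 1) (fun _ _ => 1) (fun _ _ => 0) one_pos one_pos
    (isHardSphereEulerSolution_const 0 1 0 one_pos one_pos) (fun _ => rfl) rfl rfl
    (fun t _ x => by simp)
    ⟨0, fun t _ x i => by simp [partialDeriv_const]⟩
    (fun n => ⟨1, 0, fun t _ y => by
      have h1 : (1 : ℝ) * (1 - t) ^ (-(0 : ℝ)) = 1 := by simp
      refine ⟨?_, ?_⟩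
      · rw [h1]
        exact (norm_iteratedFDeriv_lift_const_le (1 : ℝ) n y).trans (by simp)
      · rw [h1]
        exact (norm_iteratedFDeriv_lift_const_le (0 : V3) n y).trans (by simp)⟩)
    ⟨1, 0, one_pos, fun t _ x => by simp⟩
    (fun _ _ => 1 / 100) 1 one_pos
    (fun σ _ _ => ⟨show Torus.IsSmooth (fun _ : T3 => (1 / 100 : ℝ)) from contDiff_const, fun _ => by norm_num⟩)
    1 one_pos
  obtain ⟨e, he, σ₂, hσ₂, -, h⟩ := h
  obtain ⟨hσT, -, M, -, hb⟩ := h (σ₂ / 2) (by positivity) (by linarith)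
  have hT : (0 : ℝ) < 1 - (σ₂ / 2) ^ e / 2 := by
    have : 0 < (σ₂ / 2) ^ e := Real.rpow_pos_of_pos (by positivity) e
    linarith
  have key := (hb (1 - (σ₂ / 2) ^ e / 2) le_rfl (fun _ _ => 1 / 100) (fun _ _ => 1) (fun _ _ => 0)
    (isHardSphereEulerSolution_const _ _ 0 (by norm_num) one_pos) rfl rfl rfl 0 ⟨le_rfl, hT⟩ 0).2
  norm_num at key

/-- Contrapositive packaging: a proof of the rate-free stub 4 would refute the (unbundled) low-density equation of state. -/
theorem not_eos_of_stub4WithoutRate (H : Stub4WithoutRate) :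
    ¬ ∃ η₀ : ℝ, 0 < η₀ ∧ ∃ F : ℝ → ℝ, AnalyticOnNhd ℝ F (Ioo (-η₀) η₀) ∧
        EqOn hsExcessFreeEnergy F (Ico 0 η₀) ∧ F 0 = 0 ∧ deriv F 0 = 2 * Real.pi / 3 := by
  rintro ⟨η₀, hη₀, F, hF, hEq, hF0, hF'⟩
  exact stub4_false_without_rate hη₀ hF hEq hF0 hF' H

/-- In particular the route's support item `HsEosLowDensity` (stmt-0768) and the rate-free stub 4 are incompatible. -/
theorem not_hsEosLowDensity_of_stub4WithoutRate (H : Stub4WithoutRate) :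
    ¬ Summit.AtomisticToContinuum.HydrodynamicLimit.Theses.ImplosionDichotomy.HsEosLowDensity := by
  rintro ⟨η₀, hη₀, F, hF, hEq, hF0, hF', -⟩
  exact stub4_false_without_rate hη₀ hF hEq hF0 hF' H

end Summit.AtomisticToContinuum.HydrodynamicLimit.Cruxes.PolynomialCompression.DrefuteG2

end
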